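import Literature.IUT.LogThetaLattice.DHodgeTheaterGroupoid
import Literature.IUT.LogThetaLattice.StripFrameOfKits

/-!
# `±`-synchronization of representatives of isomorphisms of `𝒟-Θ^{±ell}`-Hodge theaters, and the strip projection `†ℋ𝒯 ↦ †𝔇_≻` on isomorphisms ([IUTchI] Def 6.4 (iii); [IUTchIII] Prop 1.3 (i), Rmk 1.3.1)

Mochizuki, *Inter-universal Teichmüller Theory I*, kurims manuscript (May 2020), §6, Def 6.1 (iii)(iv) p.157,
Examples 6.2 (ii), 6.3 (i) pp.160–161, Def 6.4 (i)–(iii) pp.162–163; *III*, kurims (May 2020), Prop 1.3 (i) p.42,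
Rmk 1.3.1 p.43, Thm 1.5 (i) p.48. PROOF-ONLY companion (theorems, no definitions) by the L6 cone prover
abc-iut-w4-d017 over abc-iut-L6-t3's `DHodgeTheaterRepIso.lean` / `DHodgeTheaterGroupoid.lean` /
`StripFrameOfKits.lean` and abc-iut-L5-t4's `PMBaseKit` / `PMBaseBridges` typings; nothing of theirs is restated.
DAG nodes IUTchIII:Prop1.3(i) / IUTchIII:Thm1.5(i) (plan/L6/SUBDAG-IUTchIII-Prop-13.md row Prop-13.i.r4a).
([IUTchI] Def 6.4 (iii) p.163) [claim: Mochizuki2012, status: disputed].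

QUESTION (SUBDAG-IUTchIII-Prop-13 row Prop-13.i.r4a, recorded there as open/optional): at the REAL
representative-level groupoid `DHTRep K` of `𝒟-Θ^{±ell}`-Hodge theaters, is the strip projection
`DHTRep.codFunctor : †ℋ𝒯^{𝒟-Θ±ell} ↦ †𝔇_≻` SURJECTIVE on isomorphisms, i.e. is every isomorphism of
`𝒟`-prime-strips `†𝔇_≻ ⥲ ‡𝔇_≻` induced by a (representative of an) isomorphism of `𝒟-Θ^{±ell}`-Hodge theaters?
This is the hypothesis `hsurj` of `Literature.IUT.LogThetaLattice.HTLogLink.stripLink_full` (abc-iut-L6-t3) and of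
`Literature.IUT.LogThetaLattice.LogThetaLatticeDiagram.vertical_stripLink_isFull` (this seat, `BiCoresProofs.lean`),
under which the strip log-links of a full log-link would be FULL poly-isomorphisms.

ANSWER (this file, from abc-iut-L5-t4's typed Def 6.4 alone): NO, as soon as `𝕍` has two distinct elements.
* `DHTRep.DRepIso.exists_conj_gLabMap` / `labMap_cod_eq_refl_iff_gLabMap_glob` — **`±`-SYNCHRONIZATION**: for a
  representative `a` of an automorphism of `†ℋ𝒯^{𝒟-Θ±ell}` and EVERY `v ∈ 𝕍`, the induced bijection of `±`-label classes
  of cusps of `†𝒟_{≻,v}` is conjugate to the induced bijection of the cusp labels of `†𝒟^{⊚±}`; in particular the sign of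
  `a` at `†𝒟_{≻,v}` (positive/negative automorphism, Def 6.1 (iii)) is the SAME at every `v` and is `+` iff `a` fixes
  the cusp labels of `†𝒟^{⊚±}` (paraphrase of [IUTchIII] Rmk 1.3.1 p.43: the `𝔽_l^{⋊±}`-symmetry synchronizes the
  `±`-indeterminacies at the various `v`; this file proves the representative-level form over the typed Def 6.4).
  Mechanism: Def 6.4 (ii)'s compatibility with `†φ^{Θell}_{v_0}` ties the sign at the capsule `†𝔇_0` to the action on
  the global cusps (labels of `φ^{Θell}_{•,v}`, Example 6.3 (i)), and Def 6.4 (i)'s compatibility with `†φ^{Θ±}_0`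
  ties it to the sign at `†𝔇_≻`.
* `DHTRep.DRepIso.labMap_symm_trans_cod_eq_refl_iff` — for two representatives `f g : †ℋ𝒯 ⥲ ‡ℋ𝒯`, the `+`-full
  poly-isomorphisms `†𝔇_≻ ⥲ ‡𝔇_≻` they determine differ by a sign that is the same at every `v`.
* `DHTRep.DRepIso.cod_not_surjective`, `DHTRep.codFunctor_mapIso_not_surjective`,
  `StripFrame.ofKits_dstrip_mapIso_not_surjective` — hence `Isom(†ℋ𝒯, ‡ℋ𝒯) → Isom(†𝔇_≻, ‡𝔇_≻)` is NOT surjective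
  when `v ≠ w ∈ 𝕍` exist (a target negative at `v` and positive at `w` has no preimage): of the `2^𝕍` `+`-full
  poly-isomorphisms `†𝔇_≻ ⥲ ‡𝔇_≻` (Def 6.1 (iv)) at most the two `±`-synchronized ones are induced. So the hypothesis
  `hsurj` of `stripLink_full` / `vertical_stripLink_isFull` FAILS at the real frame `StripFrame.ofKits`: the strip
  log-links of the full log-link of `𝒟-Θ^{±ell}`-Hodge theaters are not full poly-isomorphisms of prime-strips (print
  does not claim they are; [IUTchIII] Prop 1.3 (i) p.42 only defines the full log-link of Hodge theaters).
* Positive half: `DHTRep.DRepIso.exists_cod_eq_of_labMap_eq` — every `†𝔇_≻ ⥲ ‡𝔇_≻` in the `+`-full poly-isomorphism of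
  an induced one is induced (same capsule/global data); `DHTRep.DRepIso.exists_cod_eq_iff` — the image of
  `Isom(†ℋ𝒯, ‡ℋ𝒯)` in `Isom(†𝔇_≻, ‡𝔇_≻)` is the `Aut_+(‡𝔇_≻)`-orbit of one induced isomorphism, together with the
  synchronized-negative orbit EXACTLY IF `‡ℋ𝒯` admits a representative automorphism moving the cusp labels of
  `‡𝒟^{⊚±}` (the `{±1}`-symmetry `−1_{𝔽_l}` of Examples 6.2 (ii)/6.3 (ii); its existence is NOT asserted here).
HONEST FRAMING: elementary consequences of the typed definitions; no new `Prop` fact; nothing here bears on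
[IUTchIII] Cor 3.12; typed ≠ proved for the series' claims; no side taken.
-/

namespace Literature.IUT.LogThetaLattice

open CategoryTheory
open Literature.IUT.HodgeTheaters Literature.IUT.HodgeTheaters.PMBaseKit

universe u

variable {l : ℕ} {K : PMBaseKit.{u} l}

namespace DHTRep

/-! ### Label bookkeeping on a `𝒟-Θ^{±ell}`-Hodge theater -/

/-- **IUTchI:Def6.4(iii)** (kurims p.163) A bijection of index sets `𝔽_l ⥲ T` that is an isomorphism of `𝔽_l^±`-groups onto the
tautological structure (the shape of the field `exists_model`) sends `0` to the zero element of `T`.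
([IUTchI] Def 6.4 (iii) p.163) [claim: Mochizuki2012, status: disputed] -/
theorem modelIndex_zero (H : K.DThetaPMEllHT) (ι : ZMod l ≃ H.T)
    (hι : ∀ e ∈ H.grpT.charts, ι.trans e ∈ (FlPMGroup.tautological l).charts) : ι 0 = H.grpT.zero := by
  obtain ⟨ε, hε⟩ := hι _ H.grpT.chart₀_mem
  apply H.grpT.chart₀.injective
  rw [FlPMGroup.chart_zero _ H.grpT.chart₀_mem]
  have h := congrArg (fun e : ZMod l ≃ ZMod l => e 0) hε
  simp only [Equiv.trans_apply, signPerm_apply, smul_zero] at h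
  exact h.symm

/-- **IUTchI:Def6.4(i)** (kurims p.162) The index bijection `ι : T ⥲ T'` of a representative of an isomorphism of
`𝒟-Θ^{±ell}`-Hodge theaters ("an isomorphism of `𝔽_l^±`-groups") preserves the zero elements.
([IUTchI] Def 6.4 (i) p.162) [claim: Mochizuki2012, status: disputed] -/
theorem DRepIso.ι_zero {H₁ H₂ : K.DThetaPMEllHT} (f : DRepIso H₁ H₂) : f.ι H₁.grpT.zero = H₂.grpT.zero := by
  have hc := f.ι_charts _ H₂.grpT.chart₀_mem
  apply H₂.grpT.chart₀.injective
  rw [FlPMGroup.chart_zero _ H₂.grpT.chart₀_mem]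
  have h := FlPMGroup.chart_zero _ hc
  simpa only [Equiv.trans_apply] using h

/-- **IUTchI:Def6.4(ii)** (kurims p.163) LABELS OF `†φ^{Θell}_{v_t}`: all members of the poly-morphism `†φ^{Θell}_{v_t} : †𝒟_{v_t} → †𝒟^{⊚±}`
induce the SAME map from the `±`-label classes of cusps of `†𝒟_{v_t}` to the cusp labels of `†𝒟^{⊚±}`, and this map is a
bijection (Example 6.3 (i) p.161: the members are `β ∘ φ^{Θell}_{•,v} ∘ α` composed with the poly-action of `t`, with
`α ∈ Aut_+(𝒟_{v})`, `β ∈ Aut_csp(𝒟^{⊚±})`, transported by `exists_model`; `φ^{Θell}_{•,v}` is bijective on label classes,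
`PMBaseKit.labOfHom_phiEll_bijective`). ([IUTchI] Def 6.4 (ii) p.163) [claim: Mochizuki2012, status: disputed] -/
theorem polyEll_labOfHom_const (H : K.DThetaPMEllHT) (t : H.T) (v : K.V) :
    ∃ Λ : K.LabCuspPM v ((H.capsule t).obj v) ≃ K.GLab H.glob, ∀ g ∈ H.polyEll t v, K.labOfHom v g = ⇑Λ := by
  obtain ⟨ι, -, α, -, γ, -, hEll⟩ := H.exists_model
  obtain ⟨z, rfl⟩ := ι.surjective t
  refine ⟨(K.labMap v (α z v)).symm.trans <|
      (Equiv.ofBijective _ (K.labOfHom_phiEll_bijective v)).trans <|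
        (K.gChart₀.trans ((FlPM.toPerm l (FlPM.transl z)).trans K.gChart₀.symm)).trans (K.gLabMap γ), ?_⟩
  intro g hg
  rw [hEll] at hg
  obtain ⟨f, ⟨a, ha, b, hb, rfl⟩, rfl⟩ := hg
  have e1 : (α z v).inv ≫ (a.hom ≫ K.phiEll v ≫ (K.atV v).map b.hom) ≫ (K.atV v).map γ.hom =
      ((α z v).symm ≪≫ a).hom ≫ ((K.phiEll v ≫ (K.atV v).map b.hom) ≫ (K.atV v).map γ.hom) := by
    simp only [Iso.trans_hom, Iso.symm_hom, Category.assoc]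
  rw [e1, K.labOfHom_pre, K.labOfHom_post, K.labOfHom_post, K.labMap_trans, labMap_symm]
  have ha' : K.labMap v a = Equiv.refl _ := (K.mem_autPlus_iff a).mp ha
  have hb' : K.gLabMap b = K.gChart₀.trans ((FlPM.toPerm l (FlPM.transl z)).trans K.gChart₀.symm) := hb.2
  rw [ha', hb']
  funext x
  simp only [Function.comp_apply, Equiv.coe_trans, Equiv.refl_apply, Equiv.ofBijective_apply]

/-- **IUTchI:Def6.4(ii)** (kurims p.163) `†φ^{Θell}_{v_0}` is a NONEMPTY poly-morphism at the zero index (Example 6.3 (i) p.161: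
it contains the transport of `φ^{Θell}_{•,v}` itself — `α = 1`, `β = 1 ∈ Aut_csp(𝒟^{⊚±})`).
([IUTchI] Def 6.4 (ii) p.163) [claim: Mochizuki2012, status: disputed] -/
theorem polyEll_zero_nonempty (H : K.DThetaPMEllHT) (v : K.V) : (H.polyEll H.grpT.zero v).Nonempty := by
  obtain ⟨ι, hι, α, -, γ, -, hEll⟩ := H.exists_model
  have h0 : ι 0 = H.grpT.zero := modelIndex_zero H ι hι
  rw [← h0, hEll]
  refine ⟨(α 0 v).inv ≫ ((1 : Aut (K.model v)).hom ≫ K.phiEll v ≫ (K.atV v).map (1 : Aut K.gModel).hom) ≫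
      (K.atV v).map γ.hom, _, ⟨1, one_mem _, 1, ?_, rfl⟩, rfl⟩
  rw [Ex63.lifts_transl_zero]
  exact one_mem _

/-! ### `±`-synchronization -/

namespace DRepIso

variable {H H₁ H₂ : K.DThetaPMEllHT}

/-- **IUTchI:Def6.4(iii)** (kurims p.163) **`±`-SYNCHRONIZATION (conjugacy form).** For a representative `a` of an automorphism of a
`𝒟-Θ^{±ell}`-Hodge theater `†ℋ𝒯` and ANY `v ∈ 𝕍`, the bijection of cusp labels of `†𝒟^{⊚±}` induced by the global constituent
of `a` is CONJUGATE (by a bijection `LabCusp^±(†𝒟_{≻,v}) ⥲ LabCusp^±(†𝒟^{⊚±})` independent of `a`) to the bijection of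
`±`-label classes of cusps of `†𝒟_{≻,v}` induced by the constituent of `a` at `†𝔇_≻`. Ingredients: Def 6.4 (ii)
compatibility at the zero index (transport form `DRepIso.transport`) + the label calculus of `†φ^{Θell}_{v_0}`
(`polyEll_labOfHom_const`), and Def 6.4 (i) compatibility at the zero index (`compatPM`, `+`-full orbits compared by
labels). ([IUTchI] Def 6.4 (iii) p.163) [claim: Mochizuki2012, status: disputed] -/
theorem exists_conj_gLabMap (a : DRepIso H H) (v : K.V) :
    ∃ Φ : K.LabCuspPM v (H.codomain.obj v) ≃ K.GLab H.glob,
      Φ.trans (K.gLabMap a.glob) = (K.labMap v (a.cod v)).trans Φ := by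
  have h0 : a.ι H.grpT.zero = H.grpT.zero := a.ι_zero
  choose Λ hΛ using fun t => polyEll_labOfHom_const H t v
  obtain ⟨θ, hθ⟩ := H.exists_polyPM_eq
  -- Def 6.4 (i) at the zero index, compared by labels
  have E := a.compatPM H.grpT.zero
  rw [hθ, hθ, DStrip.polyComp_plusFullPolyIso, DStrip.polyComp_plusFullPolyIso,
    DStrip.plusFullPolyIso_eq_iff] at E
  have E2 : (K.labMap v (a.caps H.grpT.zero v)).trans (K.labMap v (θ (a.ι H.grpT.zero) v)) =
      (K.labMap v (θ H.grpT.zero v)).trans (K.labMap v (a.cod v)) := by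
    have Ev := E v
    simp only [DStrip.Iso.trans, K.labMap_trans] at Ev
    exact Ev
  -- Def 6.4 (ii) at the zero index, compared by labels
  have hne : (H.polyEll (a.ι H.grpT.zero) v).Nonempty := by
    rw [h0]
    exact polyEll_zero_nonempty H v
  obtain ⟨g₁, hg₁⟩ := hne
  have hk := (a.transport H.grpT.zero v g₁).mp hg₁
  have L1 := hΛ H.grpT.zero _ hk
  rw [← Iso.symm_hom, K.labOfHom_pre, K.labOfHom_post, hΛ (a.ι H.grpT.zero) g₁ hg₁, gLabMap_symm] at L1
  -- the index-`t` label identification `LabCusp^±(†𝒟_{≻,v}) ⥲ LabCusp^±(†𝒟^{⊚±})` through `θ_t` and `†φ^{Θell}_{v_t}`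
  have hΦ : ∀ w, Λ H.grpT.zero ((K.labMap v (θ H.grpT.zero v)).symm w) =
      Λ (a.ι H.grpT.zero) ((K.labMap v (θ (a.ι H.grpT.zero) v)).symm w) := fun w =>
    (congrArg (fun t => Λ t ((K.labMap v (θ t v)).symm w)) h0).symm
  refine ⟨(K.labMap v (θ H.grpT.zero v)).symm.trans (Λ H.grpT.zero), Equiv.ext fun x => ?_⟩
  simp only [Equiv.trans_apply]
  set y := (K.labMap v (θ H.grpT.zero v)).symm x with hy
  have hx : K.labMap v (θ H.grpT.zero v) y = x := Equiv.apply_symm_apply _ _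
  have L1y : K.gLabMap a.glob (Λ H.grpT.zero y) =
      Λ (a.ι H.grpT.zero) (K.labMap v (a.caps H.grpT.zero v) y) := by
    have hL := congrFun L1 y
    simp only [Function.comp_apply] at hL
    rw [← hL, Equiv.apply_symm_apply]
  have E2y : K.labMap v (θ (a.ι H.grpT.zero) v) (K.labMap v (a.caps H.grpT.zero v) y) =
      K.labMap v (a.cod v) x := by
    have hE := Equiv.ext_iff.mp E2 y
    simp only [Equiv.trans_apply, hx] at hE
    exact hE
  rw [L1y, hΦ (K.labMap v (a.cod v) x), ← E2y, Equiv.symm_apply_apply]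

/-- **IUTchI:Def6.4(iii)** (kurims p.163) **`±`-SYNCHRONIZATION.** For a representative `a` of an automorphism of a `𝒟-Θ^{±ell}`-Hodge
theater and any `v ∈ 𝕍`: the constituent `a_{≻,v} ∈ Aut(†𝒟_{≻,v})` is POSITIVE (acts trivially on `±`-label classes of
cusps, Def 6.1 (iii)) iff the global constituent of `a` fixes the cusp labels of `†𝒟^{⊚±}` (lies over `Aut_csp`). In
particular the sign at `†𝒟_{≻,v}` does not depend on `v`. ([IUTchI] Def 6.4 (iii) p.163) [claim: Mochizuki2012, status: disputed] -/
theorem labMap_cod_eq_refl_iff_gLabMap_glob (a : DRepIso H H) (v : K.V) :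
    K.labMap v (a.cod v) = Equiv.refl _ ↔ K.gLabMap a.glob = Equiv.refl _ := by
  obtain ⟨Φ, hΦ⟩ := a.exists_conj_gLabMap v
  constructor
  · intro h
    rw [h, Equiv.refl_trans] at hΦ
    have h' := congrArg (fun e => Φ.symm.trans e) hΦ
    simpa only [← Equiv.trans_assoc, Equiv.symm_trans_self, Equiv.refl_trans] using h'
  · intro h
    rw [h, Equiv.trans_refl] at hΦ
    have h' := congrArg (fun e => e.trans Φ.symm) hΦ
    simp only [Equiv.trans_assoc, Equiv.self_trans_symm, Equiv.trans_refl] at h'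
    exact h'.symm

/-- **IUTchI:Def6.4(iii)** (kurims p.163) The sign of a representative automorphism at `†𝒟_{≻,v}` is the same at all `v, w ∈ 𝕍`.
([IUTchI] Def 6.4 (iii) p.163) [claim: Mochizuki2012, status: disputed] -/
theorem labMap_cod_eq_refl_iff (a : DRepIso H H) (v w : K.V) :
    K.labMap v (a.cod v) = Equiv.refl _ ↔ K.labMap w (a.cod w) = Equiv.refl _ :=
  (a.labMap_cod_eq_refl_iff_gLabMap_glob v).trans (a.labMap_cod_eq_refl_iff_gLabMap_glob w).symm

/-- **IUTchI:Def6.4(iii)** (kurims p.163) The `+`-full poly-automorphism of `†𝔇_≻` determined by a representative automorphism of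
`†ℋ𝒯^{𝒟-Θ±ell}` is the POSITIVE one or the everywhere-NEGATIVE one (`Aut^α(†𝔇_≻)` with `α` constant, Def 6.1 (iii)/(iv);
cf. the poly-automorphism `−1_{𝔽_l}` of Example 6.2 (ii) p.160 "whose sign at every `v ∈ 𝕍` is negative").
([IUTchI] Def 6.1 (iv) p.157) [claim: Mochizuki2012, status: disputed] -/
theorem cod_mem_signedPolyAut_or (a : DRepIso H H) :
    a.cod ∈ H.codomain.signedPolyAut (fun _ => 1) ∨ a.cod ∈ H.codomain.signedPolyAut (fun _ => -1) := by
  by_cases h : K.gLabMap a.glob = Equiv.refl _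
  · left
    rw [DStrip.mem_signedPolyAut_iff]
    intro v
    exact ⟨fun _ => rfl, fun _ => (a.labMap_cod_eq_refl_iff_gLabMap_glob v).mpr h⟩
  · right
    rw [DStrip.mem_signedPolyAut_iff]
    intro v
    refine ⟨fun hv => absurd ((a.labMap_cod_eq_refl_iff_gLabMap_glob v).mp hv) h, fun hv => ?_⟩
    exact absurd (show ((-1 : ℤˣ)) = 1 from hv) (by decide)

/-- **IUTchI:Def6.4(iii)** (kurims p.163) Two representatives `f, g : †ℋ𝒯 ⥲ ‡ℋ𝒯` determine `+`-full poly-isomorphisms `†𝔇_≻ ⥲ ‡𝔇_≻`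
that differ by a `v`-INDEPENDENT sign: `f_{≻,v}⁻¹ ∘ g_{≻,v}` is positive at `v` iff it is positive at `w`.
([IUTchI] Def 6.4 (iii) p.163) [claim: Mochizuki2012, status: disputed] -/
theorem labMap_symm_trans_cod_eq_refl_iff (f g : DRepIso H₁ H₂) (v w : K.V) :
    K.labMap v ((f.cod v).symm ≪≫ g.cod v) = Equiv.refl _ ↔
      K.labMap w ((f.cod w).symm ≪≫ g.cod w) = Equiv.refl _ :=
  (f.symm.trans g).labMap_cod_eq_refl_iff v w

/-! ### Non-surjectivity of `Isom(†ℋ𝒯, ‡ℋ𝒯) → Isom(†𝔇_≻, ‡𝔇_≻)` -/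

/-- **IUTchIII:Prop1.3(i)** (kurims p.42) **NON-SURJECTIVITY.** If `𝕍` has two distinct elements `v ≠ w`, then NOT every isomorphism of
`𝒟`-prime-strips `†𝔇_≻ ⥲ ‡𝔇_≻` is the `≻`-constituent of a representative of an isomorphism `†ℋ𝒯^{𝒟-Θ±ell} ⥲ ‡ℋ𝒯^{𝒟-Θ±ell}`:
twisting an induced one by a negative automorphism at `v` only (Def 6.1 (iii): "natural surjection `Aut(†𝒟_v) ↠ {±1}`")
breaks `±`-synchronization. ([IUTchIII] Prop 1.3 (i) p.42) [claim: Mochizuki2012, status: disputed] -/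
theorem cod_not_surjective (H₁ H₂ : K.DThetaPMEllHT) {v w : K.V} (hvw : v ≠ w) :
    ¬ Function.Surjective (fun f : DRepIso H₁ H₂ => f.cod) := by
  intro hs
  obtain ⟨f⟩ := DRepIso.iso_nonempty H₁ H₂
  obtain ⟨n, hn⟩ := K.exists_negative v (H₂.codomain.obj v) (H₂.codomain.isLocal v)
  obtain ⟨g, hg⟩ := hs (f.cod.trans (Function.update (DStrip.Iso.refl H₂.codomain) v n))
  have key := labMap_symm_trans_cod_eq_refl_iff f g v w
  have hgv : (f.cod v).symm ≪≫ g.cod v = n := by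
    have e : g.cod v = f.cod v ≪≫ Function.update (DStrip.Iso.refl H₂.codomain) v n v := congrFun hg v
    rw [e, Iso.symm_self_id_assoc, Function.update_self]
  have hgw : (f.cod w).symm ≪≫ g.cod w = Iso.refl _ := by
    have e : g.cod w = f.cod w ≪≫ Function.update (DStrip.Iso.refl H₂.codomain) v n w := congrFun hg w
    rw [e, Iso.symm_self_id_assoc, Function.update_of_ne hvw.symm]
    rfl
  rw [hgv, hgw, K.labMap_refl] at key
  exact hn (key.mpr rfl)

/-! ### The image: `+`-full orbits -/

/-- **IUTchI:Def6.4(i)** (kurims p.162) POSITIVE HALF. Every isomorphism `†𝔇_≻ ⥲ ‡𝔇_≻` lying in the `+`-full poly-isomorphism of an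
induced one (same bijections of `±`-label classes at every `v`, i.e. differing by `Aut_+(‡𝔇_≻)`, Def 6.1 (iv)) is again
induced — by a representative with the same index bijection, capsule and global constituents: Def 6.4 (i) only sees the
`+`-full orbit of the `≻`-constituent, and Def 6.4 (ii) does not see it at all.
([IUTchI] Def 6.4 (i) p.162) [claim: Mochizuki2012, status: disputed] -/
theorem exists_cod_eq_of_labMap_eq (f : DRepIso H₁ H₂) (δ : H₁.codomain.Iso H₂.codomain)
    (hδ : ∀ v, K.labMap v (δ v) = K.labMap v (f.cod v)) :
    ∃ g : DRepIso H₁ H₂, g.cod = δ ∧ g.ι = f.ι ∧ g.glob = f.glob ∧ HEq g.caps f.caps :=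
  ⟨{ ι := f.ι, ι_charts := f.ι_charts, caps := f.caps, cod := δ, glob := f.glob,
      compatPM := fun t => by rw [DStrip.plusFullPolyIso_eq_iff.mpr hδ]; exact f.compatPM t,
      compatEll := f.compatEll }, rfl, rfl, rfl, HEq.refl _⟩

/-- **IUTchIII:Prop1.3(i)** (kurims p.42) **THE IMAGE of `Isom(†ℋ𝒯, ‡ℋ𝒯) → Isom(†𝔇_≻, ‡𝔇_≻)`**, relative to one representative `f`:
`δ : †𝔇_≻ ⥲ ‡𝔇_≻` is induced iff EITHER `f_≻⁻¹ ∘ δ` is positive at every `v` (the `Aut_+(‡𝔇_≻)`-orbit of `f_≻`), OR it is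
negative at every `v` AND `‡ℋ𝒯` admits a representative automorphism moving the cusp labels of `‡𝒟^{⊚±}` (the
`{±1}`-symmetry; cf. `−1_{𝔽_l}` of Examples 6.2 (ii), 6.3 (ii) — its existence is an input here, not asserted).
([IUTchIII] Prop 1.3 (i) p.42) [claim: Mochizuki2012, status: disputed] -/
theorem exists_cod_eq_iff (f : DRepIso H₁ H₂) (δ : H₁.codomain.Iso H₂.codomain) :
    (∃ g : DRepIso H₁ H₂, g.cod = δ) ↔
      (∀ v, K.labMap v ((f.cod v).symm ≪≫ δ v) = Equiv.refl _) ∨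
        ((∃ a : DRepIso H₂ H₂, K.gLabMap a.glob ≠ Equiv.refl _) ∧
          ∀ v, K.labMap v ((f.cod v).symm ≪≫ δ v) ≠ Equiv.refl _) := by
  constructor
  · rintro ⟨g, rfl⟩
    by_cases h : K.gLabMap (f.symm.trans g).glob = Equiv.refl _
    · left
      intro v
      exact ((f.symm.trans g).labMap_cod_eq_refl_iff_gLabMap_glob v).mpr h
    · right
      refine ⟨⟨f.symm.trans g, h⟩, fun v hv => h ?_⟩
      exact ((f.symm.trans g).labMap_cod_eq_refl_iff_gLabMap_glob v).mp hv
  · rintro (hpos | ⟨⟨a, ha⟩, hneg⟩)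
    · obtain ⟨g, hg, -⟩ := f.exists_cod_eq_of_labMap_eq δ fun v =>
        ((labMap_symm_trans_eq_refl_iff _ _).mp (hpos v)).symm
      exact ⟨g, hg⟩
    · have han : ∀ v, K.labMap v (a.cod v) ≠ Equiv.refl _ := fun v hv =>
        ha ((a.labMap_cod_eq_refl_iff_gLabMap_glob v).mp hv)
      obtain ⟨g, hg, -⟩ := (f.trans a).exists_cod_eq_of_labMap_eq δ fun v => by
        refine ((labMap_symm_trans_eq_refl_iff _ _).mp ?_).symm
        show K.labMap v ((f.cod v ≪≫ a.cod v).symm ≪≫ δ v) = Equiv.refl _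
        rw [Iso.trans_symm, Iso.trans_assoc,
          labMap_trans_eq_refl_iff (H₂.codomain.isLocal v) (a.cod v).symm ((f.cod v).symm ≪≫ δ v), labMap_symm]
        constructor
        · intro h1
          have h1' : K.labMap v (a.cod v) = Equiv.refl _ := by
            simpa only [Equiv.symm_symm, Equiv.refl_symm] using congrArg Equiv.symm h1
          exact absurd h1' (han v)
        · intro h2
          exact absurd h2 (hneg v)
      exact ⟨g, hg⟩

end DRepIso

/-- **IUTchIII:Prop1.3(i)** (kurims p.42) FUNCTOR FORM: for `v ≠ w ∈ 𝕍`, the strip projection `DHTRep.codFunctor : †ℋ𝒯^{𝒟-Θ±ell} ↦ †𝔇_≻` of the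
representative-level groupoid is NOT surjective on isomorphisms between any two objects ("the poly-isomorphism determined
by `Ξ` between the `𝒟`-prime-strips", [IUTchIII] Prop 1.3 (i), is `±`-synchronized, never full).
([IUTchIII] Prop 1.3 (i) p.42) [claim: Mochizuki2012, status: disputed] -/
theorem codFunctor_mapIso_not_surjective {v w : K.V} (hvw : v ≠ w) (X Y : DHTRep K) :
    ¬ Function.Surjective (fun ξ : X ≅ Y => DHTRep.codFunctor.mapIso ξ) := by
  rw [PrimeStripGroupoids.surjective_mapIso_iff]
  exact DRepIso.cod_not_surjective X.out Y.out hvw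

end DHTRep

/-! ### At the real frame `StripFrame.ofKits` -/

section Frame

open AsSmallTransport

variable {M : K.MultKit} {FK : K.FKit M} (L : FK.MonoLaws) (hbij : FK.IsomFtoDBijective)
  (hsurj : FK.IsomFmtoDmSurjective) (hR : FK.RlfOfIsStrip) (X : TimesMuSide FK L)

/-- **IUTchIII:Prop1.3(i)** (kurims p.42) SMALL-MODEL FORM: the strip projection transported to the small models `AsSmall (DHTRep K)`
(the shape of the frame field `dstrip`, `StripFrameOfKits`) is not surjective on isomorphisms, for `v ≠ w ∈ 𝕍`.
([IUTchIII] Prop 1.3 (i) p.42) [claim: Mochizuki2012, status: disputed] -/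
theorem AsSmallTransport.liftF_codFunctor_mapIso_not_surjective {v w : K.V} (hvw : v ≠ w)
    (A B : AsSmall.{max 1 u} (DHTRep K)) :
    ¬ Function.Surjective (fun f : A ≅ B => (liftF DHTRep.codFunctor).mapIso f) := by
  intro hs
  refine DHTRep.codFunctor_mapIso_not_surjective hvw (ULift.down A) (ULift.down B) fun g => ?_
  obtain ⟨f, hf⟩ := hs ((isoEquiv _ _).symm g)
  refine ⟨isoEquiv A B f, (isoEquiv _ _).symm.injective ?_⟩
  have e := congrFun (liftF_mapIso_eq DHTRep.codFunctor A B) f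
  simp only [Function.comp_apply] at e
  rw [← e]
  exact hf

/-- **IUTchIII:Thm1.5(i)** (kurims p.48) AT THE REAL FRAME `StripFrame.ofKits` (abc-iut-L6-t3, MERGE-MAP B10 part 2): for `v ≠ w ∈ 𝕍`, the strip
projection `dstrip □ : DHT ⥤ D` (`†ℋ𝒯^𝒟 ↦ †𝔇_□`, here `□ = ≻`) is NOT surjective on isomorphisms between any two `𝒟`-Hodge
theaters. Consequently the hypothesis `hsurj` of `HTLogLink.stripLink_full` / `LogThetaLatticeDiagram.vertical_stripLink_isFull`
(under which the strip log-links of the full log-link would be full poly-isomorphisms) is NOT satisfiable at the real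
frame: those conditional theorems do not fire there, in accordance with the `±`-synchronization of [IUTchIII] Rmk 1.3.1
p.43 (print asserts only the full log-link of Hodge theaters, Prop 1.3 (i) p.42 / Thm 1.5 (i) p.48).
([IUTchIII] Thm 1.5 (i) p.48) [claim: Mochizuki2012, status: disputed] -/
theorem StripFrame.ofKits_dstrip_mapIso_not_surjective {v w : K.V} (hvw : v ≠ w)
    (lab : (StripFrame.ofKits L hbij hsurj hR X).Label) (A B : (StripFrame.ofKits L hbij hsurj hR X).DHT) :
    ¬ Function.Surjective (fun ξ : A ≅ B => ((StripFrame.ofKits L hbij hsurj hR X).dstrip lab).mapIso ξ) :=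
  AsSmallTransport.liftF_codFunctor_mapIso_not_surjective hvw A B

/-- **IUTchIII:Thm1.5(i)** (kurims p.48) Hence, at the real frame with `v ≠ w ∈ 𝕍`, the frame-level hypothesis
`∀ X Y : S.DHT, Function.Surjective (fun ξ : X ≅ Y => (S.dstrip □).mapIso ξ)` of `stripLink_full` /
`vertical_stripLink_isFull` is FALSE (for every label `□`). ([IUTchIII] Thm 1.5 (i) p.48) [claim: Mochizuki2012, status: disputed] -/
theorem StripFrame.ofKits_not_dstrip_isoSurj [NeZero l] {v w : K.V} (hvw : v ≠ w)
    (lab : (StripFrame.ofKits L hbij hsurj hR X).Label) :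
    ¬ ∀ A B : (StripFrame.ofKits L hbij hsurj hR X).DHT,
      Function.Surjective (fun ξ : A ≅ B => ((StripFrame.ofKits L hbij hsurj hR X).dstrip lab).mapIso ξ) := by
  intro h
  obtain ⟨A⟩ : Nonempty (StripFrame.ofKits L hbij hsurj hR X).DHT :=
    ⟨show AsSmall.{max 1 u} (DHTRep K) from AsSmall.up.obj (DHTRep.of (Ex62.ht K))⟩
  exact StripFrame.ofKits_dstrip_mapIso_not_surjective L hbij hsurj hR X hvw lab A A (h A A)

end Frame

end Literature.IUT.LogThetaLattice
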